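import Mathlib.Analysis.InnerProductSpace.PiL2
import Mathlib.Analysis.InnerProductSpace.Dual
import Mathlib.Analysis.Convex.Exposed
import Mathlib.Analysis.Convex.Join
import Mathlib.Analysis.Normed.Affine.AddTorsorBases
import Mathlib.Analysis.LocallyConvex.Separation
import Literature.Geometry.DiscreteGeometry.Fan
import Literature.Geometry.DiscreteGeometry.KissingSaturation
import HarnessLib

/-!
# The Delaunay polyhedron of a kissing configuration: vertices, exposed `E⁺`-edges, supporting
# planes, interior origin (Hales 2012, proof of Theorem 2, first steps) — proved

Topic `Literature/Geometry/DiscreteGeometry`; provefact item for `Hales2012_kissingTwelve`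
(sibling of `FejesTothKissingTwelve.lean`).  After `TameContactGraphs.lean`, Hales's Theorem 1 is
reduced to the two computer-assisted named facts `flyspeck_L12` (Lemma 1) and
`Hales2012_contactGraphTame` (Theorem 3 with Lemma 8).  Theorem 3 rests on the *main estimate*,
Theorem 2, whose proof begins by passing to the convex hull of the configuration: "We take the
spherical Delaunay triangulation of the sphere `S²(2)` induced by `V′`. Triangles correspond to
triangulated faces of the polyhedron obtained as the convex hull of `V′ ⊂ ℝ³`."  This file PROVES
the elementary convex-geometric statements made there about that polyhedron, for any finite
packing `S ⊂ S²(2)` (twelve points and `flyspeck_L12` where saturation is needed), in particular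
for every `V ∈ 𝒱` (`IsKissingConfig`).  No solid angles, no Lexell: those are the computer part
(`[HFBBNUL]`).

## Source

Hales, arXiv:1209.6043, §4, proof of Theorem 2 (p. 6): "By standard estimates [Hal12a], by the
length constraint `‖v − w‖ < √8`, each edge of `E⁺(V′)` is an edge of this polyhedron and gives
an edge of a Delaunay triangle. […] By the kissing number problem, `V′`, which has cardinality
12, is a saturated spherical network on `S²(2)` […]. By this saturation property, if
`{u₁, u₂, u₃} ⊂ V′` is a Delaunay triangle, then the circumradius of the simplex `{0, u₁, u₂, u₃}`
is less than `2`. Since `uᵢ ∈ S²(2)`, this corresponds to a Euclidean triangular circumradius less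
than `√3` for `{u₁, u₂, u₃}`. […] Edges of Delaunay triangles that are not in `E` have length at
least `√8`. The upper bound on these edges will be determined by the circumradius constraint."
(Saturation from `L12` is `KissingSaturation.lean`; `E⁺` is `plusGraph` of `Fan.lean`.)

## What is proved (namespace `Literature.DiscreteGeom`)

* Part A [folklore]: `mem_convexHull_sep_eq_of_le` — the face of `conv S` (finite `S`) on which a
  linear functional `l ≤ M` attains `M` is `conv {s ∈ S | l s = M}`.
* Parts B–C (no `L12` needed): `inner_add_lt_of_dist_lt_sqrt_eight` — for `u, v ∈ S²(2)` with
  `‖u − v‖ < √8`, the plane `⟪u + v, ·⟫ = 4 + ⟪u, v⟫` through `u, v` has every point of `S²(2)` at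
  distance `≥ 2` from both strictly on the origin's side; hence
  `toExposed_innerSL_add_convexHull` / `isExposed_convexHull_segment`: **the segment `[u, v]` is
  an exposed face (edge) of `conv S` for every pair of a finite packing `S ⊂ S²(2)` with
  `‖u − v‖ < √8`** — all edges of `E⁺(S)` (`isExposed_convexHull_segment_of_plusGraph_adj`), in
  particular all contact edges; and `mem_exposedPoints_convexHull`: every point of `S` is a
  vertex of `conv S`.
* Part D (twelve points, `flyspeck_L12`): `h0_le_of_forall_inner_le` — every supporting
  half-space `⟪n, ·⟫ ≤ η` (`‖n‖ = 1`) of `S` has `η ≥ h₀ = 1.26` (Hales: `> 1`, from plain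
  saturation; `L12` gives the covering radius `arccos (h₀/2)`, `KissingSaturation.lean`); so the
  points of `S` on a supporting (facet) plane lie on a circle of radius
  `√(4 − η²) ≤ √(4 − h₀²) < √3` about `η n` (`norm_sub_smul_lt_sqrt_three_of_supporting`), the
  simplex `{0} ∪ facet` has circumcentre `(2/η) n` and circumradius `2/η < 2`
  (`simplex_circumradius_lt_two_of_supporting`), and two points of a facet are at distance
  `≤ 2√(4 − h₀²) < 3.1064` (`dist_le_of_supporting`).
* Part E (`flyspeck_L12`): `affineSpan_eq_top_of_L12`, `zero_mem_interior_convexHull_of_L12` —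
  `S` is not coplanar and **`0` is an interior point of `conv S`** (Hahn–Banach separation
  against Part D), i.e. `conv S` is a `3`-polytope whose facet cones at `0` cover space.
* Part F: the specialisations `IsKissingConfig.*` to Hales's class `𝒱`.

## References

* T. C. Hales, *A proof of Fejes Tóth's conjecture on sphere packings with kissing number twelve*,
  arXiv:1209.6043 (2012), §4, proof of Theorem 2, p. 6 (`Hales2012`).
* T. C. Hales, *Dense Sphere Packings. A Blueprint for Formal Proofs*, LMS Lecture Note Ser. 400,
  CUP (2012), §6 (the "standard estimates" cited as [Hal12a]) (`HalesDSP2012`).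
-/

noncomputable section

namespace Literature.Geometry.DiscreteGeometry

open RealInnerProductSpace

/-! ### Part A. The face of a polytope cut out by a linear functional [folklore] -/

section Convex

variable {V : Type*} [AddCommGroup V] [Module ℝ V]

/-- A linear functional bounded by `M` on `S` is bounded by `M` on `convexHull S`. [folklore] -/
theorem forall_convexHull_le_of_forall_le (l : V →ₗ[ℝ] ℝ) {S : Set V} {M : ℝ}
    (h : ∀ s ∈ S, l s ≤ M) : ∀ x ∈ convexHull ℝ S, l x ≤ M := fun _ hx =>
  (convexHull_min (fun s hs => (h s hs : s ∈ {y | l y ≤ M})) (convex_halfSpace_le l.isLinear M))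
    hx

/-- **The `l`-maximal face of the convex hull of a finite set is the convex hull of the
`l`-maximal points.**  If `l ≤ M` on a finite set `S` and `x ∈ convexHull S` has `l x ≥ M`, then
`x` lies in the convex hull of `{s ∈ S | l s = M}`. [folklore] -/
theorem mem_convexHull_sep_eq_of_le (l : V →ₗ[ℝ] ℝ) {S : Set V} (hS : S.Finite) {M : ℝ}
    (hM : ∀ s ∈ S, l s ≤ M) {x : V} (hx : x ∈ convexHull ℝ S) (hlx : M ≤ l x) :
    x ∈ convexHull ℝ {s ∈ S | l s = M} := by
  set A : Set V := {s ∈ S | l s = M} with hA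
  set B : Set V := {s ∈ S | l s < M} with hB
  have hAB : S = A ∪ B := by
    ext s
    simp only [hA, hB, Set.mem_union, Set.mem_setOf_eq]
    constructor
    · intro hs
      rcases (hM s hs).lt_or_eq with h | h
      · exact Or.inr ⟨hs, h⟩
      · exact Or.inl ⟨hs, h⟩
    · rintro (⟨hs, _⟩ | ⟨hs, _⟩) <;> exact hs
  have hBfin : B.Finite := hS.subset fun s hs => hs.1
  by_cases hBne : B.Nonempty
  · obtain ⟨b₀, hb₀, hb₀max⟩ := Set.exists_max_image B l hBfin hBne
    have hB' : ∀ y ∈ convexHull ℝ B, l y < M := fun y hy =>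
      (forall_convexHull_le_of_forall_le l hb₀max y hy).trans_lt hb₀.2
    by_cases hAne : A.Nonempty
    · rw [hAB, convexHull_union hAne hBne, mem_convexJoin] at hx
      obtain ⟨a, ha, b, hb, p, q, hp, hq, hpq, rfl⟩ := hx
      have hla : l a ≤ M := forall_convexHull_le_of_forall_le l (fun s hs => hs.2.le) a ha
      have hlb : l b < M := hB' b hb
      rcases hq.lt_or_eq with hq' | hq'
      · exfalso
        have h1 : l (p • a + q • b) = p * l a + q * l b := by
          rw [map_add, map_smul, map_smul, smul_eq_mul, smul_eq_mul]
        rw [h1] at hlx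
        have h3 : p * M + q * M = M := by rw [← add_mul, hpq, one_mul]
        nlinarith [mul_nonneg hp (sub_nonneg.2 hla), mul_pos hq' (sub_pos.2 hlb)]
      · subst hq'
        rw [add_zero] at hpq
        subst hpq
        simpa using ha
    · exfalso
      rw [Set.not_nonempty_iff_eq_empty] at hAne
      rw [hAB, hAne, Set.empty_union] at hx
      linarith [hB' x hx]
  · rw [Set.not_nonempty_iff_eq_empty] at hBne
    rw [hAB, hBne, Set.union_empty] at hx
    exact hx

end Convex

/-! ### Part B. Inner products on `S²(2)` -/

variable {S : Set (EuclideanSpace ℝ (Fin 3))}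

/-- On `S²(2)`: `⟪x, s⟫ ≤ 4`. [folklore] -/
theorem inner_le_four {x s : EuclideanSpace ℝ (Fin 3)} (hx : ‖x‖ = 2) (hs : ‖s‖ = 2) :
    ⟪x, s⟫ ≤ 4 := by
  have h := real_inner_le_norm x s
  rw [hx, hs] at h
  linarith

/-- On `S²(2)`: `⟪x, s⟫ = 4` only for `s = x`. [folklore] -/
theorem eq_of_inner_eq_four {x s : EuclideanSpace ℝ (Fin 3)} (hx : ‖x‖ = 2) (hs : ‖s‖ = 2)
    (h : ⟪x, s⟫ = 4) : s = x := by
  have h1 : ‖x - s‖ ^ 2 = 0 := by rw [norm_sub_sq_real, hx, hs, h]; norm_num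
  rw [sq_eq_zero_iff, norm_eq_zero, sub_eq_zero] at h1
  exact h1.symm

/-- On `S²(2)`: `⟪x, x⟫ = 4`. [folklore] -/
theorem inner_self_eq_four {x : EuclideanSpace ℝ (Fin 3)} (hx : ‖x‖ = 2) : ⟪x, x⟫ = 4 := by
  rw [real_inner_self_eq_norm_sq, hx]; norm_num

/-- **The diametral plane of a short pair.**  For `u, v, w ∈ S²(2)` with `‖u − v‖ < √8` and `w` at
distance `≥ 2` from `u` and from `v`: `⟪u + v, w⟫ ≤ 4 < 4 + ⟪u, v⟫ = ⟪u + v, u⟫ = ⟪u + v, v⟫`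
(indeed `⟪u, w⟫, ⟪v, w⟫ ≤ 2` and `⟪u, v⟫ > 0`).  So the plane `⟪u + v, ·⟫ = 4 + ⟪u, v⟫` passes
through `u, v` and has every other point of a packing on `S²(2)` strictly on the side of the
origin. [folklore] -/
theorem inner_add_lt_of_dist_lt_sqrt_eight {u v w : EuclideanSpace ℝ (Fin 3)} (hu : ‖u‖ = 2)
    (hv : ‖v‖ = 2) (hw : ‖w‖ = 2) (huv : dist u v < Real.sqrt 8) (hwu : 2 ≤ dist w u)
    (hwv : 2 ≤ dist w v) : ⟪u + v, w⟫ < ⟪u + v, u⟫ := by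
  have h1 : ⟪u, w⟫ ≤ 2 := by
    rw [real_inner_comm]; exact inner_le_two_of_two_le_dist hw hu hwu
  have h2 : ⟪v, w⟫ ≤ 2 := by
    rw [real_inner_comm]; exact inner_le_two_of_two_le_dist hw hv hwv
  have h3 : 0 < ⟪u, v⟫ := inner_pos_of_dist_lt_sqrt_eight hu hv huv
  rw [inner_add_left, inner_add_left, inner_self_eq_four hu, real_inner_comm u v]
  linarith

/-- `⟪u + v, u⟫ = ⟪u + v, v⟫ (= 4 + ⟪u, v⟫)` on `S²(2)`. [folklore] -/
theorem inner_add_left_eq_inner_add_right {u v : EuclideanSpace ℝ (Fin 3)} (hu : ‖u‖ = 2)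
    (hv : ‖v‖ = 2) : ⟪u + v, u⟫ = ⟪u + v, v⟫ := by
  rw [inner_add_left, inner_add_left, inner_self_eq_four hu, inner_self_eq_four hv,
    real_inner_comm u v]
  ring

/-! ### Part C. Vertices and exposed `E⁺`-edges of the convex hull -/

/-- **Every point of a finite `S ⊂ S²(2)` is a vertex (exposed point) of `conv S`**, exposed by
the tangent-plane functional `⟪x, ·⟫`. [folklore] -/
theorem mem_exposedPoints_convexHull (hfin : S.Finite) (hn : ∀ s ∈ S, ‖s‖ = 2)
    {x : EuclideanSpace ℝ (Fin 3)} (hx : x ∈ S) : x ∈ (convexHull ℝ S).exposedPoints ℝ := by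
  refine ⟨subset_convexHull ℝ S hx, innerSL ℝ x, fun y hy => ?_⟩
  have hM : ∀ s ∈ S, (innerSL ℝ x : EuclideanSpace ℝ (Fin 3) →ₗ[ℝ] ℝ) s ≤ 4 := fun s hs => by
    simpa [innerSL_apply_apply] using inner_le_four (hn x hx) (hn s hs)
  have hxx : innerSL ℝ x x = 4 := by rw [innerSL_apply_apply, inner_self_eq_four (hn x hx)]
  refine ⟨?_, fun hle => ?_⟩
  · rw [hxx]
    exact forall_convexHull_le_of_forall_le _ hM y hy
  · rw [hxx] at hle
    have hy' := mem_convexHull_sep_eq_of_le _ hfin hM hy hle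
    have hsing : {s ∈ S | (innerSL ℝ x : EuclideanSpace ℝ (Fin 3) →ₗ[ℝ] ℝ) s = 4} = {x} := by
      ext s
      simp only [Set.mem_setOf_eq, Set.mem_singleton_iff, ContinuousLinearMap.coe_coe,
        innerSL_apply_apply]
      constructor
      · rintro ⟨hs, h4⟩
        exact eq_of_inner_eq_four (hn x hx) (hn s hs) h4
      · rintro rfl
        exact ⟨hx, inner_self_eq_four (hn s hx)⟩
    rw [hsing, convexHull_singleton] at hy'
    exact hy'

/-- The points of `S` maximising `⟪u + v, ·⟫` are exactly `u` and `v`, for a short pair `{u, v}`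
of a packing on `S²(2)`. [folklore] -/
theorem sep_inner_add_eq_eq_pair (hn : ∀ s ∈ S, ‖s‖ = 2)
    (hp : ∀ s ∈ S, ∀ t ∈ S, s ≠ t → 2 ≤ dist s t) {u v : EuclideanSpace ℝ (Fin 3)} (hu : u ∈ S)
    (hv : v ∈ S) (huv : dist u v < Real.sqrt 8) :
    {s ∈ S | (innerSL ℝ (u + v) : EuclideanSpace ℝ (Fin 3) →ₗ[ℝ] ℝ) s = ⟪u + v, u⟫} = {u, v} := by
  ext s
  simp only [Set.mem_setOf_eq, Set.mem_insert_iff, Set.mem_singleton_iff,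
    ContinuousLinearMap.coe_coe, innerSL_apply_apply]
  constructor
  · rintro ⟨hs, he⟩
    by_contra hne
    push Not at hne
    have h1 : 2 ≤ dist s u := hp s hs u hu hne.1
    have h2 : 2 ≤ dist s v := hp s hs v hv hne.2
    have := inner_add_lt_of_dist_lt_sqrt_eight (hn u hu) (hn v hv) (hn s hs) huv h1 h2
    linarith
  · rintro (rfl | rfl)
    · exact ⟨hu, rfl⟩
    · exact ⟨hv, (inner_add_left_eq_inner_add_right (hn u hu) (hn s hv)).symm⟩

/-- **The face of `conv S` cut out by `⟪u + v, ·⟫` is the segment `[u, v]`**, for a short pair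
`{u, v}` (`‖u − v‖ < √8`) of a finite packing `S ⊂ S²(2)`. [folklore] -/
theorem toExposed_innerSL_add_convexHull (hfin : S.Finite) (hn : ∀ s ∈ S, ‖s‖ = 2)
    (hp : ∀ s ∈ S, ∀ t ∈ S, s ≠ t → 2 ≤ dist s t) {u v : EuclideanSpace ℝ (Fin 3)} (hu : u ∈ S)
    (hv : v ∈ S) (huv : dist u v < Real.sqrt 8) :
    (innerSL ℝ (u + v)).toExposed (convexHull ℝ S) = segment ℝ u v := by
  set l : EuclideanSpace ℝ (Fin 3) →L[ℝ] ℝ := innerSL ℝ (u + v) with hl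
  have hM : ∀ s ∈ S, (l : EuclideanSpace ℝ (Fin 3) →ₗ[ℝ] ℝ) s ≤ l u := by
    intro s hs
    simp only [ContinuousLinearMap.coe_coe, hl, innerSL_apply_apply]
    by_cases hsu : s = u
    · rw [hsu]
    by_cases hsv : s = v
    · rw [hsv, inner_add_left_eq_inner_add_right (hn u hu) (hn v hv)]
    exact (inner_add_lt_of_dist_lt_sqrt_eight (hn u hu) (hn v hv) (hn s hs) huv
      (hp s hs u hu hsu) (hp s hs v hv hsv)).le
  have hhull : ∀ y ∈ convexHull ℝ S, l y ≤ l u := forall_convexHull_le_of_forall_le _ hM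
  have hluv : l v = l u := by
    simp only [hl, innerSL_apply_apply]
    exact (inner_add_left_eq_inner_add_right (hn u hu) (hn v hv)).symm
  ext x
  simp only [ContinuousLinearMap.toExposed, Set.mem_setOf_eq]
  constructor
  · rintro ⟨hx, hmax⟩
    have hle : l u ≤ l x := hmax u (subset_convexHull ℝ S hu)
    have hx' := mem_convexHull_sep_eq_of_le _ hfin hM hx hle
    have hpair := sep_inner_add_eq_eq_pair hn hp hu hv huv
    simp only [hl] at hx' hpair
    rw [show ⟪u + v, u⟫ = innerSL ℝ (u + v) u from (innerSL_apply_apply ℝ _ _).symm] at hpair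
    rw [hpair, convexHull_pair] at hx'
    exact hx'
  · intro hx
    refine ⟨segment_subset_convexHull hu hv hx, fun y hy => ?_⟩
    obtain ⟨p, q, hp0, hq0, hpq, rfl⟩ := hx
    have h1 : l (p • u + q • v) = l u := by
      rw [map_add, map_smul, map_smul, hluv, smul_eq_mul, smul_eq_mul, ← add_mul, hpq, one_mul]
    rw [h1]
    exact hhull y hy

/-- **Hales 2012, proof of Theorem 2: "each edge of `E⁺(V′)` is an edge of this polyhedron"**
(the convex hull of `V′`, whose boundary is the spherical Delaunay triangulation): for a finite
packing `S ⊂ S²(2)` and `u, v ∈ S` with `‖u − v‖ < √8`, the segment `[u, v]` is an exposed face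
of `conv S` — exposed by the plane `⟪u + v, ·⟫ = 4 + ⟪u, v⟫`, which contains `u, v` and has all
other points of `S` strictly on the origin's side (`inner_add_lt_of_dist_lt_sqrt_eight`).  Hales
cites "standard estimates [Hal12a]" for this; the two-line argument above is the whole proof.
[cite: Hales2012, proof of Theorem 2 (p. 6)] -/
theorem isExposed_convexHull_segment (hfin : S.Finite) (hn : ∀ s ∈ S, ‖s‖ = 2)
    (hp : ∀ s ∈ S, ∀ t ∈ S, s ≠ t → 2 ≤ dist s t) {u v : EuclideanSpace ℝ (Fin 3)} (hu : u ∈ S)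
    (hv : v ∈ S) (huv : dist u v < Real.sqrt 8) :
    IsExposed ℝ (convexHull ℝ S) (segment ℝ u v) := fun _ =>
  ⟨innerSL ℝ (u + v), (toExposed_innerSL_add_convexHull hfin hn hp hu hv huv).symm⟩

/-- The same for the edges of Hales's graph `(V, E⁺(V))` (`plusGraph`, Definition 7:
`2 ≤ ‖u − v‖ < √8`), in particular for all contact edges. [cite: Hales2012, proof of Theorem 2 (p. 6)] -/
theorem isExposed_convexHull_segment_of_plusGraph_adj (hfin : S.Finite) (hn : ∀ s ∈ S, ‖s‖ = 2)
    (hp : ∀ s ∈ S, ∀ t ∈ S, s ≠ t → 2 ≤ dist s t) {x y : S} (h : (plusGraph S).Adj x y) :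
    IsExposed ℝ (convexHull ℝ S) (segment ℝ (x : EuclideanSpace ℝ (Fin 3)) y) :=
  isExposed_convexHull_segment hfin hn hp x.2 y.2 h.2

/-! ### Part D. Supporting planes are far from the origin (from `L12`) -/

/-- **Supporting half-spaces of a twelve-point packing on `S²(2)` have height `≥ h₀`** (assuming
`flyspeck_L12`): if `‖n‖ = 1` and `⟪n, s⟫ ≤ η` for all `s ∈ S`, then `η ≥ h₀ = 1.26`.  Indeed
some `s ∈ S` has `⟪2n, s⟫ ≥ 2h₀` (`exists_two_mul_h0_le_inner_of_L12`, the covering-radius form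
of the kissing number problem).  Hales uses the weaker consequence of plain saturation, `η > 1`.
[cite: Hales2012, proof of Theorem 2 (p. 6)] -/
theorem h0_le_of_forall_inner_le (hL12 : flyspeck_L12) (h12 : S.ncard = 12)
    (hn : ∀ s ∈ S, ‖s‖ = 2) (hp : ∀ s ∈ S, ∀ t ∈ S, s ≠ t → 2 ≤ dist s t)
    {n : EuclideanSpace ℝ (Fin 3)} (hn1 : ‖n‖ = 1) {η : ℝ} (h : ∀ s ∈ S, ⟪n, s⟫ ≤ η) :
    hales_h0 ≤ η := by
  have hx : ‖(2 : ℝ) • n‖ = 2 := by rw [norm_smul, hn1, Real.norm_two, mul_one]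
  obtain ⟨s, hs, h2⟩ := exists_two_mul_h0_le_inner_of_L12 hL12 h12 hn hp hx
  rw [real_inner_smul_left] at h2
  linarith [h s hs]

/-- Hence **`S` lies in no closed half-space through the origin** (assuming `flyspeck_L12`):
for every unit vector `n` some `s ∈ S` has `⟪n, s⟫ ≥ h₀ > 0`. [cite: Hales2012, proof of Theorem 2 (p. 6)] -/
theorem exists_h0_le_inner (hL12 : flyspeck_L12) (h12 : S.ncard = 12)
    (hn : ∀ s ∈ S, ‖s‖ = 2) (hp : ∀ s ∈ S, ∀ t ∈ S, s ≠ t → 2 ≤ dist s t)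
    {n : EuclideanSpace ℝ (Fin 3)} (hn1 : ‖n‖ = 1) : ∃ s ∈ S, hales_h0 ≤ ⟪n, s⟫ := by
  by_contra hcon
  push Not at hcon
  have hfin : S.Finite := Set.finite_of_ncard_ne_zero (by rw [h12]; norm_num)
  have hne : S.Nonempty := Set.nonempty_of_ncard_ne_zero (by rw [h12]; norm_num)
  obtain ⟨s₀, hs₀, hmax⟩ := Set.exists_max_image S (fun s => ⟪n, s⟫) hfin hne
  have := h0_le_of_forall_inner_le hL12 h12 hn hp hn1 hmax
  linarith [hcon s₀ hs₀]

/-- **Points of `S` on a supporting plane `⟪n, ·⟫ = η` lie on a circle of radius `√(4 − η²)`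
about `η n`.** [folklore] -/
theorem norm_sub_smul_sq_of_inner_eq {s n : EuclideanSpace ℝ (Fin 3)} (hs : ‖s‖ = 2)
    (hn1 : ‖n‖ = 1) {η : ℝ} (h : ⟪n, s⟫ = η) : ‖s - η • n‖ ^ 2 = 4 - η ^ 2 := by
  rw [norm_sub_sq_real, norm_smul, hn1, hs, Real.norm_eq_abs, mul_one, sq_abs,
    real_inner_smul_right, real_inner_comm, h]
  ring

/-- `4 − h₀² = 2.4124 < 3`. [folklore] -/
theorem four_sub_h0_sq_lt_three : 4 - hales_h0 ^ 2 < 3 := by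
  rw [hales_h0_eq]; norm_num

/-- **Hales 2012, proof of Theorem 2: the facets of the Delaunay polyhedron have circumradius
`< √3`.**  "By this saturation property, if `{u₁, u₂, u₃} ⊂ V′` is a Delaunay triangle, then the
circumradius of the simplex `{0, u₁, u₂, u₃}` is less than `2`. Since `uᵢ ∈ S²(2)`, this
corresponds to a Euclidean triangular circumradius less than `√3` for `{u₁, u₂, u₃}`."  Proved
form (assuming `flyspeck_L12`): if the plane `⟪n, ·⟫ = η` (`‖n‖ = 1`) supports `S` (all of `S`
has `⟪n, ·⟫ ≤ η`), then every `s ∈ S` on that plane satisfies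
`‖s − η n‖² = 4 − η² ≤ 4 − h₀² (= 2.4124) < 3`: the points of `S` on a facet plane of `conv S`
lie on a circle of radius `< √3` (indeed `≤ 1.5532`). [cite: Hales2012, proof of Theorem 2 (p. 6)] -/
theorem norm_sub_smul_sq_le_of_supporting (hL12 : flyspeck_L12) (h12 : S.ncard = 12)
    (hn : ∀ s ∈ S, ‖s‖ = 2) (hp : ∀ s ∈ S, ∀ t ∈ S, s ≠ t → 2 ≤ dist s t)
    {n : EuclideanSpace ℝ (Fin 3)} (hn1 : ‖n‖ = 1) {η : ℝ} (h : ∀ s ∈ S, ⟪n, s⟫ ≤ η)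
    {s : EuclideanSpace ℝ (Fin 3)} (hs : s ∈ S) (hse : ⟪n, s⟫ = η) :
    ‖s - η • n‖ ^ 2 ≤ 4 - hales_h0 ^ 2 := by
  rw [norm_sub_smul_sq_of_inner_eq (hn s hs) hn1 hse]
  have h0η : hales_h0 ≤ η := h0_le_of_forall_inner_le hL12 h12 hn hp hn1 h
  have h0pos : 0 < hales_h0 := by rw [hales_h0_eq]; norm_num
  nlinarith

/-- The circumradius bound as printed: `‖s − η n‖ < √3`. [cite: Hales2012, proof of Theorem 2 (p. 6)] -/
theorem norm_sub_smul_lt_sqrt_three_of_supporting (hL12 : flyspeck_L12) (h12 : S.ncard = 12)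
    (hn : ∀ s ∈ S, ‖s‖ = 2) (hp : ∀ s ∈ S, ∀ t ∈ S, s ≠ t → 2 ≤ dist s t)
    {n : EuclideanSpace ℝ (Fin 3)} (hn1 : ‖n‖ = 1) {η : ℝ} (h : ∀ s ∈ S, ⟪n, s⟫ ≤ η)
    {s : EuclideanSpace ℝ (Fin 3)} (hs : s ∈ S) (hse : ⟪n, s⟫ = η) :
    ‖s - η • n‖ < Real.sqrt 3 := by
  have h1 := norm_sub_smul_sq_le_of_supporting hL12 h12 hn hp hn1 h hs hse
  rw [Real.lt_sqrt (norm_nonneg _)]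
  linarith [four_sub_h0_sq_lt_three]

/-- **The simplex form**: with `c = (2/η) n`, every `s ∈ S` on the supporting plane has
`dist c s = ‖c‖ = 2/η` (so `c` is the circumcentre of the simplex `{0} ∪ (S ∩ plane)`), and
`2/η ≤ 2/h₀ < 2` — "the circumradius of the simplex `{0, u₁, u₂, u₃}` is less than `2`".
[cite: Hales2012, proof of Theorem 2 (p. 6)] -/
theorem simplex_circumradius_lt_two_of_supporting (hL12 : flyspeck_L12) (h12 : S.ncard = 12)
    (hn : ∀ s ∈ S, ‖s‖ = 2) (hp : ∀ s ∈ S, ∀ t ∈ S, s ≠ t → 2 ≤ dist s t)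
    {n : EuclideanSpace ℝ (Fin 3)} (hn1 : ‖n‖ = 1) {η : ℝ} (h : ∀ s ∈ S, ⟪n, s⟫ ≤ η) :
    ‖(2 / η) • n‖ = 2 / η ∧ (∀ s ∈ S, ⟪n, s⟫ = η → dist ((2 / η) • n) s = 2 / η) ∧ 2 / η < 2 := by
  have h0η : hales_h0 ≤ η := h0_le_of_forall_inner_le hL12 h12 hn hp hn1 h
  have h0 : (1.26 : ℝ) ≤ η := by rw [hales_h0_eq] at h0η; exact h0η
  have hηpos : 0 < η := by linarith
  have hc : ‖(2 / η) • n‖ = 2 / η := by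
    rw [norm_smul, hn1, mul_one, Real.norm_of_nonneg (by positivity)]
  refine ⟨hc, fun s hs hse => ?_, ?_⟩
  · have h1 : dist ((2 / η) • n) s ^ 2 = (2 / η) ^ 2 := by
      rw [dist_eq_norm, norm_sub_sq_real, hc, hn s hs, real_inner_smul_left, hse]
      field_simp
      ring
    have h2 : 0 ≤ dist ((2 / η) • n) s := dist_nonneg
    have h3 : (0 : ℝ) ≤ 2 / η := by positivity
    nlinarith [h1]
  · rw [div_lt_iff₀ hηpos]; linarith

/-- **Diameter of a facet.**  Two points of `S` on a common supporting plane `⟪n, ·⟫ = η` are at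
distance `≤ 2√(4 − h₀²)` (`≈ 3.107 < 2√3`), assuming `flyspeck_L12` — "The upper bound on these
edges will be determined by the circumradius constraint" (Hales bounds the non-`E⁺` edges of a
Delaunay triangle through its circumradius `< √3`). [cite: Hales2012, proof of Theorem 2 (p. 6)] -/
theorem dist_le_of_supporting (hL12 : flyspeck_L12) (h12 : S.ncard = 12)
    (hn : ∀ s ∈ S, ‖s‖ = 2) (hp : ∀ s ∈ S, ∀ t ∈ S, s ≠ t → 2 ≤ dist s t)
    {n : EuclideanSpace ℝ (Fin 3)} (hn1 : ‖n‖ = 1) {η : ℝ} (h : ∀ s ∈ S, ⟪n, s⟫ ≤ η)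
    {s t : EuclideanSpace ℝ (Fin 3)} (hs : s ∈ S) (hse : ⟪n, s⟫ = η) (ht : t ∈ S)
    (hte : ⟪n, t⟫ = η) : dist s t ≤ 2 * Real.sqrt (4 - hales_h0 ^ 2) := by
  have h1 := norm_sub_smul_sq_le_of_supporting hL12 h12 hn hp hn1 h hs hse
  have h2 := norm_sub_smul_sq_le_of_supporting hL12 h12 hn hp hn1 h ht hte
  have h1' : ‖s - η • n‖ ≤ Real.sqrt (4 - hales_h0 ^ 2) := Real.le_sqrt_of_sq_le h1
  have h2' : ‖t - η • n‖ ≤ Real.sqrt (4 - hales_h0 ^ 2) := Real.le_sqrt_of_sq_le h2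
  calc dist s t = ‖(s - η • n) - (t - η • n)‖ := by rw [dist_eq_norm, sub_sub_sub_cancel_right]
    _ ≤ ‖s - η • n‖ + ‖t - η • n‖ := norm_sub_le _ _
    _ ≤ 2 * Real.sqrt (4 - hales_h0 ^ 2) := by linarith

/-- Numerically, `2√(4 − h₀²) < 3.1064` (and `< 2√3 ≈ 3.4641`, Hales's bound from plain
saturation). [folklore] -/
theorem two_mul_sqrt_four_sub_h0_sq_lt : 2 * Real.sqrt (4 - hales_h0 ^ 2) < 3.1064 := by
  have h : Real.sqrt (4 - hales_h0 ^ 2) < 1.5532 := by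
    rw [Real.sqrt_lt' (by norm_num), hales_h0_eq]; norm_num
  linarith

/-! ### Part E. The origin is an interior point of the convex hull (from `L12`) -/

/-- `S` is not contained in a plane: its affine span is all of `ℝ³` (assuming `flyspeck_L12`).
[cite: Hales2012, proof of Theorem 2 (p. 6)] -/
theorem affineSpan_eq_top_of_L12 (hL12 : flyspeck_L12) (h12 : S.ncard = 12)
    (hn : ∀ s ∈ S, ‖s‖ = 2) (hp : ∀ s ∈ S, ∀ t ∈ S, s ≠ t → 2 ≤ dist s t) :
    affineSpan ℝ S = ⊤ := by
  have hne : S.Nonempty := Set.nonempty_of_ncard_ne_zero (by rw [h12]; norm_num)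
  by_contra htop
  have hdir : (affineSpan ℝ S).direction ≠ ⊤ := by
    rwa [Ne, AffineSubspace.direction_eq_top_iff_of_nonempty
      ((affineSpan_nonempty (k := ℝ)).2 hne)]
  rw [direction_affineSpan] at hdir
  have horth : (vectorSpan ℝ S)ᗮ ≠ ⊥ := by
    rwa [Ne, Submodule.orthogonal_eq_bot_iff]
  obtain ⟨m, hm, hm0⟩ := (Submodule.ne_bot_iff _).1 horth
  obtain ⟨s₀, hs₀⟩ := hne
  -- `⟪m, s⟫` is constant on `S`
  have hconst : ∀ s ∈ S, ⟪m, s⟫ = ⟪m, s₀⟫ := by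
    intro s hs
    have h1 : s -ᵥ s₀ ∈ vectorSpan ℝ S := vsub_mem_vectorSpan ℝ hs hs₀
    have h2 : ⟪s -ᵥ s₀, m⟫ = 0 := Submodule.inner_right_of_mem_orthogonal h1 hm
    rw [vsub_eq_sub, inner_sub_left, sub_eq_zero] at h2
    rw [real_inner_comm, h2, real_inner_comm]
  have hmpos : 0 < ‖m‖ := norm_pos_iff.2 hm0
  set n : EuclideanSpace ℝ (Fin 3) := ‖m‖⁻¹ • m with hn'
  have hn1 : ‖n‖ = 1 := by
    rw [hn', norm_smul, norm_inv, norm_norm, inv_mul_cancel₀ hmpos.ne']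
  have hn1' : ‖-n‖ = 1 := by rw [norm_neg, hn1]
  have h1 := h0_le_of_forall_inner_le hL12 h12 hn hp hn1 (η := ‖m‖⁻¹ * ⟪m, s₀⟫)
    (fun s hs => by rw [hn', real_inner_smul_left, hconst s hs])
  have h2 := h0_le_of_forall_inner_le hL12 h12 hn hp hn1' (η := -(‖m‖⁻¹ * ⟪m, s₀⟫))
    (fun s hs => by rw [inner_neg_left, hn', real_inner_smul_left, hconst s hs])
  have h0pos : 0 < hales_h0 := by rw [hales_h0_eq]; norm_num
  linarith

/-- **The origin is an interior point of `conv S`** for a twelve-point packing `S ⊂ S²(2)`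
(assuming `flyspeck_L12`): otherwise a plane through `0` would support `conv S`, contradicting
`exists_h0_le_inner`.  (This is what makes the cones over the facets of the Delaunay polyhedron
partition space, so that their solid angles add up to `4π`.) [cite: Hales2012, proof of Theorem 2 (p. 6)] -/
theorem zero_mem_interior_convexHull_of_L12 (hL12 : flyspeck_L12) (h12 : S.ncard = 12)
    (hn : ∀ s ∈ S, ‖s‖ = 2) (hp : ∀ s ∈ S, ∀ t ∈ S, s ≠ t → 2 ≤ dist s t) :
    (0 : EuclideanSpace ℝ (Fin 3)) ∈ interior (convexHull ℝ S) := by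
  by_contra h0
  have hC : Convex ℝ (convexHull ℝ S) := convex_convexHull ℝ S
  have hint : (interior (convexHull ℝ S)).Nonempty :=
    interior_convexHull_nonempty_iff_affineSpan_eq_top.2 (affineSpan_eq_top_of_L12 hL12 h12 hn hp)
  obtain ⟨f, hf⟩ := geometric_hahn_banach_open_point hC.interior isOpen_interior h0
  rw [map_zero] at hf
  -- `f ≤ 0` on the closure of the interior, which contains `S`
  have hle : ∀ s ∈ S, f s ≤ 0 := by
    intro s hs
    have hs' : s ∈ closure (interior (convexHull ℝ S)) := by
      rw [hC.closure_interior_eq_closure_of_nonempty_interior hint]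
      exact subset_closure (subset_convexHull ℝ S hs)
    exact closure_minimal (fun a ha => (hf a ha).le) (isClosed_le f.continuous continuous_const) hs'
  -- `f = ⟪m, ·⟫` with `m ≠ 0`
  set m : EuclideanSpace ℝ (Fin 3) := (InnerProductSpace.toDual ℝ _).symm f with hm
  have hfm : ∀ a, f a = ⟪m, a⟫ := fun a => by rw [hm, InnerProductSpace.toDual_symm_apply]
  obtain ⟨a, ha⟩ := hint
  have hm0 : m ≠ 0 := by
    intro hm0
    have := hf a ha
    rw [hfm, hm0, inner_zero_left] at this
    exact lt_irrefl _ this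
  have hmpos : 0 < ‖m‖ := norm_pos_iff.2 hm0
  have hn1 : ‖‖m‖⁻¹ • m‖ = 1 := by
    rw [norm_smul, norm_inv, norm_norm, inv_mul_cancel₀ hmpos.ne']
  have h1 := h0_le_of_forall_inner_le hL12 h12 hn hp hn1 (η := 0) (fun s hs => by
    rw [real_inner_smul_left, ← hfm]
    exact mul_nonpos_of_nonneg_of_nonpos (inv_nonneg.2 (norm_nonneg _)) (hle s hs))
  rw [hales_h0_eq] at h1
  norm_num at h1

/-! ### Part F. Specialisation to Hales's class `𝒱` -/

/-- Every point of `V ∈ 𝒱` is a vertex of `conv V`. [folklore] -/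
theorem IsKissingConfig.mem_exposedPoints_convexHull (hS : IsKissingConfig S)
    {x : EuclideanSpace ℝ (Fin 3)} (hx : x ∈ S) : x ∈ (convexHull ℝ S).exposedPoints ℝ :=
  Literature.Geometry.DiscreteGeometry.mem_exposedPoints_convexHull hS.finite (fun _ hs => hS.norm_eq hs) hx

/-- For `V ∈ 𝒱`, every edge of `E⁺(V)` — in particular every contact edge — spans an exposed
edge of `conv V`. [cite: Hales2012, proof of Theorem 2 (p. 6)] -/
theorem IsKissingConfig.isExposed_convexHull_segment (hS : IsKissingConfig S)
    {u v : EuclideanSpace ℝ (Fin 3)} (hu : u ∈ S) (hv : v ∈ S) (huv : dist u v < Real.sqrt 8) :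
    IsExposed ℝ (convexHull ℝ S) (segment ℝ u v) :=
  Literature.Geometry.DiscreteGeometry.isExposed_convexHull_segment hS.finite (fun _ hs => hS.norm_eq hs)
    (fun _ hs _ ht hst => hS.two_le_dist hs ht hst) hu hv huv

/-- For `V ∈ 𝒱`, contact edges span exposed edges of `conv V`. [cite: Hales2012, proof of Theorem 2 (p. 6)] -/
theorem IsKissingConfig.isExposed_convexHull_segment_of_adj (hS : IsKissingConfig S) {x y : S}
    (h : (contactGraph S).Adj x y) :
    IsExposed ℝ (convexHull ℝ S) (segment ℝ (x : EuclideanSpace ℝ (Fin 3)) y) :=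
  hS.isExposed_convexHull_segment x.2 y.2 (contactGraph_le_plusGraph S h).2

/-- For `V ∈ 𝒱` (assuming `flyspeck_L12`), supporting half-spaces `⟪n, ·⟫ ≤ η` (`‖n‖ = 1`) have
`η ≥ h₀`. [cite: Hales2012, proof of Theorem 2 (p. 6)] -/
theorem IsKissingConfig.h0_le_of_forall_inner_le (hL12 : flyspeck_L12) (hS : IsKissingConfig S)
    {n : EuclideanSpace ℝ (Fin 3)} (hn1 : ‖n‖ = 1) {η : ℝ} (h : ∀ s ∈ S, ⟪n, s⟫ ≤ η) :
    hales_h0 ≤ η :=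
  Literature.Geometry.DiscreteGeometry.h0_le_of_forall_inner_le hL12 hS.ncard_eq (fun _ hs => hS.norm_eq hs)
    (fun _ hs _ ht hst => hS.two_le_dist hs ht hst) hn1 h

/-- For `V ∈ 𝒱` (assuming `flyspeck_L12`), the points of `V` on a supporting plane lie on a
circle of radius `< √3` ("Euclidean triangular circumradius less than `√3`").
[cite: Hales2012, proof of Theorem 2 (p. 6)] -/
theorem IsKissingConfig.norm_sub_smul_lt_sqrt_three (hL12 : flyspeck_L12) (hS : IsKissingConfig S)
    {n : EuclideanSpace ℝ (Fin 3)} (hn1 : ‖n‖ = 1) {η : ℝ} (h : ∀ s ∈ S, ⟪n, s⟫ ≤ η)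
    {s : EuclideanSpace ℝ (Fin 3)} (hs : s ∈ S) (hse : ⟪n, s⟫ = η) :
    ‖s - η • n‖ < Real.sqrt 3 :=
  norm_sub_smul_lt_sqrt_three_of_supporting hL12 hS.ncard_eq (fun _ hs => hS.norm_eq hs)
    (fun _ hs _ ht hst => hS.two_le_dist hs ht hst) hn1 h hs hse

/-- For `V ∈ 𝒱` (assuming `flyspeck_L12`), two points of `V` on a common supporting plane of
`conv V` are at distance `≤ 2√(4 − h₀²) < 3.1064`. [cite: Hales2012, proof of Theorem 2 (p. 6)] -/
theorem IsKissingConfig.dist_le_of_supporting (hL12 : flyspeck_L12) (hS : IsKissingConfig S)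
    {n : EuclideanSpace ℝ (Fin 3)} (hn1 : ‖n‖ = 1) {η : ℝ} (h : ∀ s ∈ S, ⟪n, s⟫ ≤ η)
    {s t : EuclideanSpace ℝ (Fin 3)} (hs : s ∈ S) (hse : ⟪n, s⟫ = η) (ht : t ∈ S)
    (hte : ⟪n, t⟫ = η) : dist s t ≤ 2 * Real.sqrt (4 - hales_h0 ^ 2) :=
  Literature.Geometry.DiscreteGeometry.dist_le_of_supporting hL12 hS.ncard_eq (fun _ hs => hS.norm_eq hs)
    (fun _ hs _ ht hst => hS.two_le_dist hs ht hst) hn1 h hs hse ht hte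

/-- For `V ∈ 𝒱` (assuming `flyspeck_L12`), `0` is an interior point of `conv V`.
[cite: Hales2012, proof of Theorem 2 (p. 6)] -/
theorem IsKissingConfig.zero_mem_interior_convexHull (hL12 : flyspeck_L12)
    (hS : IsKissingConfig S) : (0 : EuclideanSpace ℝ (Fin 3)) ∈ interior (convexHull ℝ S) :=
  zero_mem_interior_convexHull_of_L12 hL12 hS.ncard_eq (fun _ hs => hS.norm_eq hs)
    (fun _ hs _ ht hst => hS.two_le_dist hs ht hst)

end Literature.Geometry.DiscreteGeometry
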